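import Summits.KontsevichZagierPeriods.KontsevichZagierPeriods.Theses.EulerFormChain
import Summits.KontsevichZagierPeriods.KontsevichZagierPeriods.Theorems.InverseLandauTateLiftingBallPolydisc

/-!
# `BallCalibrationSix` (stmt-KontsevichZagierPeriods-11797, route EulerFormChain) — proof

`6·[B̄₆, 1] − [D̄³, 1] ∈ KZ.relations` (`vol₆ B̄₆ = π³/6`): the `k = 3` instance of
`Summit.KontsevichZagierPeriods.InverseLandau.ballPolydisc` (`Theorems/InverseLandauTateLiftingBallPolydisc.lean`, line `Sketch` of
crux `TateLifting`, stubs 62–65).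
-/

namespace Summit.KontsevichZagierPeriods.EulerFormChain

/-- **`BallCalibrationSix`** (route EulerFormChain, stmt-KontsevichZagierPeriods-11797): for the integrand-`1` representations `b`
over the closed unit ball of `ℝ⁶` and `p` over the closed tridisc `D̄³ ⊂ ℝ⁶`, `6·[b] − [p] ∈ KZ.relations`.
Proof: `InverseLandau.ballCalibrationSix`. [cite: KontsevichZagier2001, §1.2] -/
theorem ballCalibrationSix_proof :
    Summit.KontsevichZagierPeriods.KontsevichZagierPeriods.Theses.EulerFormChain.BallCalibrationSix :=
  Summit.KontsevichZagierPeriods.InverseLandau.ballCalibrationSix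

end Summit.KontsevichZagierPeriods.EulerFormChain
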